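import Summits.QuantumFields.YangMills.Theorems.SwapVirialDeficitBlowUpGnomonicRingChart
import HarnessLib

/-!
# G1-joint, Bochner form: the σ-glued ring measure in the joint gnomonic chart for bounded REAL integrands

fcl-p3 g46's ask (ym-idea-1 STATUS 14:23:57Z): the signed virial terms of the ring-side corollary (`N − W`, `R = F̂ − ½XF̂`) and the ring terms
`∫ F e^{−bF} dμ_L`, `Z(b) = ∫ e^{−bF} dμ_L` are REAL Bochner integrals; this file turns ✓`lintegral_ringMeasure_eq_gnomonic` (`[0,∞]`-valued) into the
Bochner identity for every bounded measurable seam-invariant real `G`: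

* §1 (bounded measurable `G`, `|G| ≤ M`): `measurable_gnomonic_integrand_real`, `measurable_gnomonicPoint_prod` ∕ `measurable_gnomonic_integrand_prod`
  (JOINT measurability in `(a, η)`), ★ `integrable_gnomonic_fibre` (`η ↦ G(…)·gnoDensity η`, ✓`integrable_gnoDensity`), `abs_integral_gnomonic_fibre_le`
  (`≤ M·∫gnoDensity`), ★ `stronglyMeasurable_gnomonic_fibre_integral` (✓Mathlib `StronglyMeasurable.integral_prod_right'`), ★ `integrable_gnomonic_fibre_sum`
  (`a ↦ Σ_ε ∫ G(…)·gnoDensity` is cone-integrable);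
* §2 ★★ `integral_ringMeasure_eq_gnomonic_of_nonneg` (`0 ≤ G ≤ M`: `ENNReal.toReal` of the `lintegral` form, every inner integral finite), ★★★
  `integral_ringMeasure_eq_gnomonic (κ) (hχ) (hG : Measurable G) (hbd : ∀ p, |G p| ≤ M) (hinv)` —
  `∫ G dμ_L = (coneConst³/64 · (2π²)^{-|Fol L|}) · ∫_cone Σ_{ε : GnoSign L} ∫_{η : GnoCoord L} G(fixHistory (ringConfig χ (blowUpPoint 1 (gnomonicPoint a ε η))))·gnoDensity η dη da`
  (shift trick `G + M`, minus the constant), ★ `gnomonic_total_mass_real`.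

HONEST LABEL: an exact change of variables at fixed `L` (measure-theory plumbing for the window programme of a DRAFT line); no estimate on ⟨24197⟩
(window-uniform, OPEN); ⟨24194⟩ ∕ ⟨24497⟩ OPEN; own crux ⟨22884⟩ OPEN (blocked-on ⟨19935⟩); no crux, rung of record or summit is proved; the Yang–Mills mass
gap is NOT proved; no summit is proved by a line.  THEOREMS ONLY (0 `def`, 0 `sorry`), standard axioms.  Width seat ym-line-sfw-p2-w2 g57 (cell ym-idea-1,
free hands), `--supports stmt-QuantumFields-24197`.  References: [cite: tHooft1979]; [cite: Luscher1983, §2]; [folklore].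
-/

set_option autoImplicit false
set_option synthInstance.maxSize 1024

noncomputable section

open MeasureTheory Quaternion Set
open scoped Quaternion ENNReal BigOperators
open Literature.MathematicalPhysics.QuantumLattice
open Literature.MathematicalPhysics.QuantumFieldTheory hiding SU2
open Summit.QuantumFields.YangMills.Theorems.SwapTwistDeficit.ToronLog

attribute [local instance] Literature.Analysis.FluidPDE.Tao2016.quatMeasurableSpace
  Literature.Analysis.FluidPDE.Tao2016.quatBorelSpace
  Literature.MathematicalPhysics.QuantumLattice.secondCountableTopology_su2

namespace Summit.QuantumFields.YangMills.Theorems.SwapVirialDeficit.BlowUpRing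

open Summit.QuantumFields.YangMills.Theorems.FemtoTransferGap
open Summit.QuantumFields.YangMills.Theorems.FemtoTransferGap.TT
open Summit.QuantumFields.YangMills.Theorems.VirialFluxGap.RingDeficit
open Summit.QuantumFields.YangMills.Theorems.SwapVirialDeficit.SwapRing

variable {L : ℕ} [NeZero L]

/-! ## §1 Measurability and integrability of the gnomonic fibre integrand for a bounded real integrand -/

section Fibre

variable (χ : Site 3 L → SU2) {G : (Fin (2 * L - 1 + 1) → GaugeConfig 3 L SU2) × (Site 3 L → SU2) → ℝ}

/-- The real integrand read in the joint gnomonic chart is measurable in `η`. [folklore] -/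
theorem measurable_gnomonic_integrand_real (hG : Measurable G) (a : ℍ) (ε : GnoSign L) :
    Measurable fun η : GnoCoord L => G (fixHistory (ringConfig χ (blowUpPoint 1 (gnomonicPoint a ε η)))) :=
  hG.comp (measurable_fixHistory.comp ((measurable_ringConfig χ).comp ((measurable_blowUpPoint 1).comp (measurable_gnomonicPoint a ε))))

omit [NeZero L] in
/-- `(a, η) ↦ gnomonicPoint a ε η` is jointly measurable. [folklore] -/
theorem measurable_gnomonicPoint_prod (ε : GnoSign L) : Measurable fun p : ℍ × GnoCoord L => gnomonicPoint p.1 ε p.2 := by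
  show Measurable fun p : ℍ × GnoCoord L => (p.1, (gnomonicPoint (L := L) 0 ε p.2).2)
  exact measurable_fst.prodMk ((measurable_snd.comp (measurable_gnomonicPoint 0 ε)).comp measurable_snd)

/-- The real integrand read in the joint gnomonic chart is JOINTLY measurable in `(a, η)`. [folklore] -/
theorem measurable_gnomonic_integrand_prod (hG : Measurable G) (ε : GnoSign L) :
    Measurable fun p : ℍ × GnoCoord L => G (fixHistory (ringConfig χ (blowUpPoint 1 (gnomonicPoint p.1 ε p.2)))) :=
  hG.comp (measurable_fixHistory.comp ((measurable_ringConfig χ).comp ((measurable_blowUpPoint 1).comp (measurable_gnomonicPoint_prod ε))))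

/-- ★ The fibre integrand `η ↦ G(…)·gnoDensity η` of a BOUNDED measurable `G` is integrable (✓`integrable_gnoDensity`). [folklore] -/
theorem integrable_gnomonic_fibre (hG : Measurable G) {M : ℝ} (hbd : ∀ p, |G p| ≤ M) (a : ℍ) (ε : GnoSign L) :
    Integrable (fun η : GnoCoord L => G (fixHistory (ringConfig χ (blowUpPoint 1 (gnomonicPoint a ε η)))) * gnoDensity η) :=
  (integrable_gnoDensity.const_mul M).mono' ((measurable_gnomonic_integrand_real χ hG a ε).mul measurable_gnoDensity).aestronglyMeasurable
    (Filter.Eventually.of_forall fun η => by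
      rw [Real.norm_eq_abs, abs_mul, abs_of_nonneg (gnoDensity_pos η).le]
      exact mul_le_mul_of_nonneg_right (hbd _) (gnoDensity_pos η).le)

/-- `|∫ G(…)·gnoDensity| ≤ M · ∫ gnoDensity`. [folklore] -/
theorem abs_integral_gnomonic_fibre_le {M : ℝ} (hbd : ∀ p, |G p| ≤ M) (a : ℍ) (ε : GnoSign L) :
    |∫ η : GnoCoord L, G (fixHistory (ringConfig χ (blowUpPoint 1 (gnomonicPoint a ε η)))) * gnoDensity η| ≤ M * ∫ η : GnoCoord L, gnoDensity η := by
  rw [← integral_const_mul]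
  refine (abs_integral_le_integral_abs).trans (integral_mono_of_nonneg (Filter.Eventually.of_forall fun η => abs_nonneg _)
    (integrable_gnoDensity.const_mul M) (Filter.Eventually.of_forall fun η => ?_))
  show |G (fixHistory (ringConfig χ (blowUpPoint 1 (gnomonicPoint a ε η)))) * gnoDensity η| ≤ M * gnoDensity η
  rw [abs_mul, abs_of_nonneg (gnoDensity_pos η).le]
  exact mul_le_mul_of_nonneg_right (hbd _) (gnoDensity_pos η).le

/-- ★ The fibre integral `a ↦ ∫ G(…)·gnoDensity` is strongly measurable in the hub (✓Mathlib `StronglyMeasurable.integral_prod_right'`). [folklore] -/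
theorem stronglyMeasurable_gnomonic_fibre_integral (hG : Measurable G) (ε : GnoSign L) :
    StronglyMeasurable fun a : ℍ => ∫ η : GnoCoord L, G (fixHistory (ringConfig χ (blowUpPoint 1 (gnomonicPoint a ε η)))) * gnoDensity η := by
  have h : StronglyMeasurable fun p : ℍ × GnoCoord L => G (fixHistory (ringConfig χ (blowUpPoint 1 (gnomonicPoint p.1 ε p.2)))) * gnoDensity p.2 :=
    ((measurable_gnomonic_integrand_prod χ hG ε).mul (measurable_gnoDensity.comp measurable_snd)).stronglyMeasurable
  exact h.integral_prod_right'

/-- ★ The summed fibre integral `a ↦ Σ_ε ∫ G(…)·gnoDensity` is integrable for the cone law (bounded by `|GnoSign L|·M·∫gnoDensity`, cone law finite). [folklore] -/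
theorem integrable_gnomonic_fibre_sum (hG : Measurable G) {M : ℝ} (hbd : ∀ p, |G p| ≤ M) :
    Integrable (fun a : ℍ => ∑ ε : GnoSign L, ∫ η : GnoCoord L, G (fixHistory (ringConfig χ (blowUpPoint 1 (gnomonicPoint a ε η)))) * gnoDensity η)
      coneMeasure := by
  haveI := isProbabilityMeasure_coneMeasure
  refine integrable_finsetSum _ fun ε _ => ?_
  exact (integrable_const (M * ∫ η : GnoCoord L, gnoDensity η)).mono' (stronglyMeasurable_gnomonic_fibre_integral χ hG ε).aestronglyMeasurable
    (Filter.Eventually.of_forall fun a => by rw [Real.norm_eq_abs]; exact abs_integral_gnomonic_fibre_le χ hbd a ε)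

end Fibre

/-! ## §2 The Bochner form of the joint gnomonic ring chart -/

/-- ★★ **NON-NEGATIVE BOUNDED INTEGRANDS**: for central `χ` and measurable seam-invariant `0 ≤ G ≤ M`,
`∫ G dμ_L = (coneConst³/64 · (2π²)^{-|Fol L|}) · ∫_cone Σ_ε ∫_η G(fixHistory (ringConfig χ (blowUpPoint 1 (gnomonicPoint a ε η))))·gnoDensity η dη da`
(`ENNReal.toReal` of ✓`lintegral_ringMeasure_eq_gnomonic`; all inner integrals finite by ✓`integrable_gnoDensity`). [cite: Luscher1983, §2] -/
theorem integral_ringMeasure_eq_gnomonic_of_nonneg (κ : Site 3 L → Site 3 L) {χ : Site 3 L → SU2} (hχ : ∀ (x : Site 3 L) (k : SU2), k * χ x = χ x * k)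
    {G : (Fin (2 * L - 1 + 1) → GaugeConfig 3 L SU2) × (Site 3 L → SU2) → ℝ} (hG : Measurable G) (h0 : ∀ p, 0 ≤ G p) {M : ℝ} (hM : ∀ p, G p ≤ M)
    (hinv : ∀ (h : Site 3 L → SU2) (p : (Fin (2 * L - 1 + 1) → GaugeConfig 3 L SU2) × (Site 3 L → SU2)),
      G ((fun i => gaugeTransform h (p.1 i)), h * p.2 * (h ∘ κ)⁻¹) = G p) :
    ∫ p, G p ∂(ringMeasure L) =
      (coneConst ^ 3 / 64 * (1 / (2 * Real.pi ^ 2)) ^ Fintype.card (Fol L)) *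
        ∫ a, (∑ ε : GnoSign L, ∫ η : GnoCoord L, G (fixHistory (ringConfig χ (blowUpPoint 1 (gnomonicPoint a ε η)))) * gnoDensity η) ∂coneMeasure := by
  haveI := isProbabilityMeasure_coneMeasure
  have hbd : ∀ p, |G p| ≤ M := fun p => by rw [abs_of_nonneg (h0 p)]; exact hM p
  have hKr : (0 : ℝ) ≤ coneConst ^ 3 / 64 * (1 / (2 * Real.pi ^ 2)) ^ Fintype.card (Fol L) := by
    have := coneConst_pos; positivity
  have hGE : Measurable fun p => ENNReal.ofReal (G p) := ENNReal.measurable_ofReal.comp hG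
  have key := lintegral_ringMeasure_eq_gnomonic κ hχ hGE (fun h p => by simp only [hinv h p])
  -- the fibres: `∫⁻ ofReal G · ofReal ρ = ofReal (∫ G ρ)`
  have hfib : ∀ (a : ℍ) (ε : GnoSign L),
      ∫⁻ η : GnoCoord L, ENNReal.ofReal (G (fixHistory (ringConfig χ (blowUpPoint 1 (gnomonicPoint a ε η))))) * ENNReal.ofReal (gnoDensity η) =
        ENNReal.ofReal (∫ η : GnoCoord L, G (fixHistory (ringConfig χ (blowUpPoint 1 (gnomonicPoint a ε η)))) * gnoDensity η) := fun a ε => by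
    rw [ofReal_integral_eq_lintegral_ofReal (integrable_gnomonic_fibre χ hG hbd a ε)
      (Filter.Eventually.of_forall fun η => mul_nonneg (h0 _) (gnoDensity_pos η).le)]
    refine lintegral_congr fun η => ?_
    rw [← ENNReal.ofReal_mul (h0 _)]
  have hsum : ∀ a : ℍ, (∑ ε : GnoSign L, ∫⁻ η : GnoCoord L,
      ENNReal.ofReal (G (fixHistory (ringConfig χ (blowUpPoint 1 (gnomonicPoint a ε η))))) * ENNReal.ofReal (gnoDensity η)) =
        ENNReal.ofReal (∑ ε : GnoSign L, ∫ η : GnoCoord L, G (fixHistory (ringConfig χ (blowUpPoint 1 (gnomonicPoint a ε η)))) * gnoDensity η) :=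
    fun a => by
      rw [ENNReal.ofReal_sum_of_nonneg fun ε _ => integral_nonneg fun η => mul_nonneg (h0 _) (gnoDensity_pos η).le]
      exact Finset.sum_congr rfl fun ε _ => hfib a ε
  have hnn : ∀ a : ℍ, 0 ≤ ∑ ε : GnoSign L, ∫ η : GnoCoord L, G (fixHistory (ringConfig χ (blowUpPoint 1 (gnomonicPoint a ε η)))) * gnoDensity η :=
    fun a => Finset.sum_nonneg fun ε _ => integral_nonneg fun η => mul_nonneg (h0 _) (gnoDensity_pos η).le
  rw [integral_eq_lintegral_of_nonneg_ae (Filter.Eventually.of_forall h0) hG.aestronglyMeasurable, key, lintegral_congr hsum,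
    ← ofReal_integral_eq_lintegral_ofReal (integrable_gnomonic_fibre_sum χ hG hbd) (Filter.Eventually.of_forall hnn),
    ENNReal.toReal_mul, ENNReal.toReal_ofReal hKr, ENNReal.toReal_ofReal (integral_nonneg hnn)]
set_option maxHeartbeats 400000 in
/-- ★★★ **THE JOINT GNOMONIC RING CHART, BOCHNER FORM** (fcl-p3 g46's ask, 14:23:57Z): for central `χ` and every BOUNDED measurable seam-invariant
real `G` (`|G| ≤ M`),
`∫ G dμ_L = (coneConst³/64 · (2π²)^{-|Fol L|}) · ∫_cone Σ_{ε : GnoSign L} ∫_{η : GnoCoord L} G(fixHistory (ringConfig χ (blowUpPoint 1 (gnomonicPoint a ε η))))·gnoDensity η dη da`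
(shift trick: the non-negative form for `G + M` and for the constant `M`, subtracted). [cite: Luscher1983, §2] -/
theorem integral_ringMeasure_eq_gnomonic (κ : Site 3 L → Site 3 L) {χ : Site 3 L → SU2} (hχ : ∀ (x : Site 3 L) (k : SU2), k * χ x = χ x * k)
    {G : (Fin (2 * L - 1 + 1) → GaugeConfig 3 L SU2) × (Site 3 L → SU2) → ℝ} (hG : Measurable G) {M : ℝ} (hbd : ∀ p, |G p| ≤ M)
    (hinv : ∀ (h : Site 3 L → SU2) (p : (Fin (2 * L - 1 + 1) → GaugeConfig 3 L SU2) × (Site 3 L → SU2)),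
      G ((fun i => gaugeTransform h (p.1 i)), h * p.2 * (h ∘ κ)⁻¹) = G p) :
    ∫ p, G p ∂(ringMeasure L) =
      (coneConst ^ 3 / 64 * (1 / (2 * Real.pi ^ 2)) ^ Fintype.card (Fol L)) *
        ∫ a, (∑ ε : GnoSign L, ∫ η : GnoCoord L, G (fixHistory (ringConfig χ (blowUpPoint 1 (gnomonicPoint a ε η)))) * gnoDensity η) ∂coneMeasure := by
  haveI : IsProbabilityMeasure (ringMeasure L) := isProbabilityMeasure_ringMeasure (L := L)
  haveI := isProbabilityMeasure_coneMeasure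
  have hM : 0 ≤ M := (abs_nonneg _).trans (hbd (Classical.arbitrary _))
  -- the shifted integrand `G + M` and the constant `M`
  have h1 := integral_ringMeasure_eq_gnomonic_of_nonneg κ hχ (G := fun p => G p + M) (hG.add_const M)
    (fun p => by linarith [neg_le_of_abs_le (hbd p)]) (M := 2 * M) (fun p => by linarith [le_of_abs_le (hbd p)])
    (fun h p => by simp only [hinv h p])
  have h2 := integral_ringMeasure_eq_gnomonic_of_nonneg κ hχ (G := fun _ => M) measurable_const (fun _ => hM) (M := M) (fun _ => le_rfl)
    (fun _ _ => rfl)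
  have hbd1 : ∀ p, |G p + M| ≤ 2 * M := fun p => abs_le.2 ⟨by linarith [neg_le_of_abs_le (hbd p)], by linarith [le_of_abs_le (hbd p)]⟩
  have hbd2 : ∀ _p : (Fin (2 * L - 1 + 1) → GaugeConfig 3 L SU2) × (Site 3 L → SU2), |M| ≤ M := fun _ => (abs_of_nonneg hM).le
  -- ring side: `∫ G = ∫ (G + M) − ∫ M`
  have hGi : Integrable G (ringMeasure L) :=
    (integrable_const M).mono' hG.aestronglyMeasurable (Filter.Eventually.of_forall fun p => by rw [Real.norm_eq_abs]; exact hbd p)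
  have eL : ∫ p, G p ∂(ringMeasure L) = (∫ p, (G p + M) ∂(ringMeasure L)) - ∫ _p, M ∂(ringMeasure L) := by
    rw [integral_add hGi (integrable_const M)]; ring
  -- chart side: fibrewise `∫ (G+M)ρ − ∫ Mρ = ∫ Gρ`
  have efib : ∀ (a : ℍ) (ε : GnoSign L),
      (∫ η : GnoCoord L, (G (fixHistory (ringConfig χ (blowUpPoint 1 (gnomonicPoint a ε η)))) + M) * gnoDensity η) -
          ∫ η : GnoCoord L, M * gnoDensity η =
        ∫ η : GnoCoord L, G (fixHistory (ringConfig χ (blowUpPoint 1 (gnomonicPoint a ε η)))) * gnoDensity η := fun a ε => by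
    rw [← integral_sub (integrable_gnomonic_fibre χ (G := fun p => G p + M) (hG.add_const M) hbd1 a ε) (integrable_gnoDensity.const_mul M)]
    refine integral_congr_ae (Filter.Eventually.of_forall fun η => ?_)
    show (G (fixHistory (ringConfig χ (blowUpPoint 1 (gnomonicPoint a ε η)))) + M) * gnoDensity η - M * gnoDensity η = _
    ring
  rw [eL, h1, h2, ← mul_sub, ← integral_sub (integrable_gnomonic_fibre_sum χ (G := fun p => G p + M) (hG.add_const M) hbd1)
    (integrable_gnomonic_fibre_sum χ (G := fun _ => M) measurable_const hbd2)]
  congr 1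
  refine integral_congr_ae (Filter.Eventually.of_forall fun a => ?_)
  show (∑ ε : GnoSign L, ∫ η : GnoCoord L, (G (fixHistory (ringConfig χ (blowUpPoint 1 (gnomonicPoint a ε η)))) + M) * gnoDensity η) -
      ∑ ε : GnoSign L, ∫ η : GnoCoord L, M * gnoDensity η = _
  rw [← Finset.sum_sub_distrib]
  exact Finset.sum_congr rfl fun ε _ => efib a ε

/-- ★ The total mass in Bochner form: `(coneConst³/64 · (2π²)^{-|Fol|}) · Σ_ε ∫ gnoDensity = 1`. [folklore] -/
theorem gnomonic_total_mass_real {χ : Site 3 L → SU2} (hχ : ∀ (x : Site 3 L) (k : SU2), k * χ x = χ x * k) :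
    (coneConst ^ 3 / 64 * (1 / (2 * Real.pi ^ 2)) ^ Fintype.card (Fol L)) * ∑ _ε : GnoSign L, ∫ η : GnoCoord L, gnoDensity η = 1 := by
  haveI : IsProbabilityMeasure (ringMeasure L) := isProbabilityMeasure_ringMeasure (L := L)
  haveI := isProbabilityMeasure_coneMeasure
  have h := integral_ringMeasure_eq_gnomonic_of_nonneg (L := L) id hχ (G := fun _ => (1 : ℝ)) measurable_const (fun _ => zero_le_one) (M := 1)
    (fun _ => le_rfl) (fun _ _ => rfl)
  simp only [integral_const, probReal_univ, smul_eq_mul, one_mul] at h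
  exact h.symm

end Summit.QuantumFields.YangMills.Theorems.SwapVirialDeficit.BlowUpRing

end
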